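import Mathlib.Analysis.Analytic.IsolatedZeros
import Mathlib.Analysis.Calculus.IteratedDeriv.Lemmas
import Mathlib.Analysis.Complex.RealDeriv
import Mathlib.Analysis.SpecialFunctions.Complex.Analytic
import Mathlib.Topology.Connected.Basic
import HarnessLib

/-!
# Auxiliary lemmas: a continuous real root selects one analytic branch

Topic `Literature/FieldTheory/AlgClosed` (support for the real half of Puiseux's theorem,
`PuiseuxRealGerm.lean`).

* `exists_branch_eqOn`: if finitely many continuous complex branches `Y_v`, pairwise distinct off `0`,
  exhaust the values of a CONTINUOUS real function `g` on `(0, δ)` pointwise, then `g` coincides with ONE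
  branch on all of `(0, δ)` (connectedness of the interval).
* `iteratedDeriv_re_ofReal_eq`: real iterated derivatives of `t ↦ Re H(t)` along the real axis are the
  real parts of the complex iterated derivatives of a holomorphic `H`.
* `iteratedDeriv_pow_mul_eq`: Taylor coefficients of `z ↦ zᵐ H(z)` are those of `H`, shifted.
* `eventually_eq_zero_of_forall_Ioo`: a holomorphic germ vanishing on a real interval `(0, ε)` vanishes
  identically near `0`.

All elementary; [folklore].

## References

* J. Bochnak, M. Coste, M.-F. Roy, *Real Algebraic Geometry* (1998), §8.1 (real Puiseux branches).
  [BochnakCosteRoy1998]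
-/

noncomputable section

namespace Literature.FieldTheory.AlgClosed

open Filter Topology Set

/-! ### A continuous real root selects one branch -/

/-- **Branch selection by connectedness.** Let `Y_v`, `v ∈ S`, be finitely many functions `ℂ → ℂ`,
continuous on the disc `|s| < r` and pairwise distinct at every `s ≠ 0` of the disc, and let
`g : ℝ → ℝ` be continuous on `(0, δ)`, `δ ≤ r`, with `g(s) ∈ {Y_v(s)}` for every `s ∈ (0, δ)`. Then one
branch `v₀` satisfies `g = Y_{v₀}` on all of `(0, δ)`. [folklore] -/
theorem exists_branch_eqOn {ι : Type*} (S : Finset ι) (Y : ι → ℂ → ℂ) {r δ : ℝ} (hδ : 0 < δ)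
    (hδr : δ ≤ r)
    (hYc : ∀ v ∈ S, ∀ s ∈ Metric.ball (0 : ℂ) r, ContinuousAt (Y v) s)
    (hdist : ∀ s ∈ Metric.ball (0 : ℂ) r, s ≠ 0 → ∀ v ∈ S, ∀ v' ∈ S, v ≠ v' → Y v s ≠ Y v' s)
    (g : ℝ → ℝ) (hg : ContinuousOn g (Set.Ioo 0 δ))
    (hex : ∀ s ∈ Set.Ioo (0 : ℝ) δ, ∃ v ∈ S, ((g s : ℝ) : ℂ) = Y v s) :
    ∃ v ∈ S, ∀ s ∈ Set.Ioo (0 : ℝ) δ, ((g s : ℝ) : ℂ) = Y v s := by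
  classical
  -- real points of `(0, δ)` lie in the punctured disc
  have hball : ∀ s ∈ Set.Ioo (0 : ℝ) δ, ((s : ℝ) : ℂ) ∈ Metric.ball (0 : ℂ) r ∧ ((s : ℝ) : ℂ) ≠ 0 := by
    intro s hs
    refine ⟨?_, ?_⟩
    · rw [Metric.mem_ball, dist_zero_right, Complex.norm_real, Real.norm_eq_abs, abs_of_pos hs.1]
      exact lt_of_lt_of_le hs.2 hδr
    · exact_mod_cast hs.1.ne'
  set U : ι → Set ℝ := fun v => {s | s ∈ Set.Ioo (0 : ℝ) δ ∧ ((g s : ℝ) : ℂ) = Y v s} with hU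
  -- each `U v` is open
  have hUopen : ∀ v ∈ S, IsOpen (U v) := by
    intro v hv
    rw [isOpen_iff_mem_nhds]
    rintro s₁ ⟨hs₁, hg₁⟩
    have hIoo : Set.Ioo (0 : ℝ) δ ∈ 𝓝 s₁ := isOpen_Ioo.mem_nhds hs₁
    have hgc : ContinuousAt g s₁ := hg.continuousAt hIoo
    have hgc' : ContinuousAt (fun t : ℝ => ((g t : ℝ) : ℂ)) s₁ := Complex.continuous_ofReal.continuousAt.comp hgc
    have hYc' : ∀ w ∈ S, ContinuousAt (fun t : ℝ => Y w ((t : ℝ) : ℂ)) s₁ := fun w hw =>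
      (hYc w hw _ (hball s₁ hs₁).1).comp Complex.continuous_ofReal.continuousAt
    -- near `s₁`, `g` stays away from every other branch
    have hsep : ∀ v' ∈ S, v' ≠ v → ∀ᶠ t : ℝ in 𝓝 s₁, ((g t : ℝ) : ℂ) ≠ Y v' ((t : ℝ) : ℂ) := by
      intro v' hv' hne
      set d : ℝ := dist (Y v' ((s₁ : ℝ) : ℂ)) (Y v ((s₁ : ℝ) : ℂ)) with hd
      have hdpos : 0 < d := dist_pos.mpr (hdist _ (hball s₁ hs₁).1 (hball s₁ hs₁).2 v' hv' v hv hne)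
      have h1 : ∀ᶠ t : ℝ in 𝓝 s₁, dist (Y v' ((t : ℝ) : ℂ)) (Y v' ((s₁ : ℝ) : ℂ)) < d / 3 :=
        Metric.tendsto_nhds.mp (hYc' v' hv') (d / 3) (by positivity)
      have h2 : ∀ᶠ t : ℝ in 𝓝 s₁, dist (((g t : ℝ) : ℂ)) (((g s₁ : ℝ) : ℂ)) < d / 3 :=
        Metric.tendsto_nhds.mp hgc' (d / 3) (by positivity)
      filter_upwards [h1, h2] with t ht1 ht2 heq
      rw [heq, hg₁] at ht2
      have := dist_triangle (Y v' ((s₁ : ℝ) : ℂ)) (Y v' ((t : ℝ) : ℂ)) (Y v ((s₁ : ℝ) : ℂ))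
      rw [dist_comm (Y v' ((s₁ : ℝ) : ℂ)) (Y v' ((t : ℝ) : ℂ))] at this
      linarith
    have hall : ∀ᶠ t : ℝ in 𝓝 s₁, ∀ v' ∈ S.erase v, ((g t : ℝ) : ℂ) ≠ Y v' ((t : ℝ) : ℂ) :=
      (Filter.eventually_all_finset _).mpr fun v' hv' =>
        hsep v' (Finset.mem_of_mem_erase hv') (Finset.ne_of_mem_erase hv')
    filter_upwards [hIoo, hall] with t ht hall'
    obtain ⟨w, hw, hwt⟩ := hex t ht
    by_cases hwv : w = v
    · exact ⟨ht, hwv ▸ hwt⟩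
    · exact absurd hwt (hall' w (Finset.mem_erase.mpr ⟨hwv, hw⟩))
  -- a base point and its branch
  obtain ⟨s₀, hs₀⟩ : (Set.Ioo (0 : ℝ) δ).Nonempty := ⟨δ / 2, by constructor <;> linarith⟩
  obtain ⟨v₀, hv₀, h0⟩ := hex s₀ hs₀
  refine ⟨v₀, hv₀, fun s hs => ?_⟩
  have hsub : Set.Ioo (0 : ℝ) δ ⊆ U v₀ := by
    refine (isPreconnected_Ioo).subset_left_of_subset_union (hUopen v₀ hv₀)
      (isOpen_biUnion fun v hv => hUopen v (Finset.mem_of_mem_erase hv)) ?_ ?_ ⟨s₀, hs₀, hs₀, h0⟩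
      (s := Set.Ioo (0 : ℝ) δ) (v := ⋃ v ∈ S.erase v₀, U v)
    · rw [Set.disjoint_left]
      rintro t ⟨ht, ht0⟩ hmem
      obtain ⟨v, hv, htv⟩ := Set.mem_iUnion₂.mp hmem
      exact hdist _ (hball t ht).1 (hball t ht).2 v₀ hv₀ v (Finset.mem_of_mem_erase hv)
        (Finset.ne_of_mem_erase hv).symm (ht0.symm.trans htv.2)
    · intro t ht
      obtain ⟨w, hw, hwt⟩ := hex t ht
      by_cases hwv : w = v₀
      · exact Or.inl ⟨ht, hwv ▸ hwt⟩
      · exact Or.inr (Set.mem_iUnion₂.mpr ⟨w, Finset.mem_erase.mpr ⟨hwv, hw⟩, ht, hwt⟩)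
  exact (hsub hs).2

/-! ### Real parts of holomorphic functions along the real axis -/

/-- Along the real axis, the real iterated derivatives of `t ↦ Re H(t)` are the real parts of the
complex iterated derivatives of a function `H` holomorphic near the real point `t₀`. [folklore] -/
theorem iteratedDeriv_re_ofReal_eq (n : ℕ) :
    ∀ {H : ℂ → ℂ} {t₀ : ℝ}, (∀ᶠ t : ℝ in 𝓝 t₀, AnalyticAt ℂ H ((t : ℝ) : ℂ)) →
      iteratedDeriv n (fun t : ℝ => (H ((t : ℝ) : ℂ)).re) t₀ = (iteratedDeriv n H ((t₀ : ℝ) : ℂ)).re := by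
  induction n with
  | zero => intro H t₀ _; simp
  | succ n ih =>
    intro H t₀ hH
    have hderiv : (deriv fun t : ℝ => (H ((t : ℝ) : ℂ)).re) =ᶠ[𝓝 t₀]
        fun t : ℝ => (deriv H ((t : ℝ) : ℂ)).re := by
      filter_upwards [hH] with t ht
      exact (ht.differentiableAt.hasDerivAt.real_of_complex).deriv
    have hH' : ∀ᶠ t : ℝ in 𝓝 t₀, AnalyticAt ℂ (deriv H) ((t : ℝ) : ℂ) := by
      filter_upwards [hH] with t ht using ht.deriv
    rw [iteratedDeriv_succ', iteratedDeriv_succ', hderiv.iteratedDeriv_eq n, ih hH']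

/-! ### Taylor coefficients of `zᵐ H(z)` -/

/-- The `(n + m)`-th derivative at `0` of `z ↦ zᵐ H(z)` is `C(n+m, m) · m! · H⁽ⁿ⁾(0)`. [folklore] -/
theorem iteratedDeriv_pow_mul_eq {H : ℂ → ℂ} (hH : AnalyticAt ℂ H 0) (m n : ℕ) :
    iteratedDeriv (n + m) (fun z : ℂ => z ^ m * H z) 0 =
      (((n + m).choose m * m.factorial : ℕ) : ℂ) * iteratedDeriv n H 0 := by
  have hf : ContDiffAt ℂ (n + m : ℕ) (fun z : ℂ => z ^ m) 0 := (analyticAt_id.pow m).contDiffAt.of_le le_top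
  have hg : ContDiffAt ℂ (n + m : ℕ) H 0 := hH.contDiffAt.of_le le_top
  have hmul := iteratedDeriv_mul hf hg
  change iteratedDeriv (n + m) (fun z : ℂ => z ^ m * H z) 0 = _ at hmul
  rw [hmul, Finset.sum_eq_single m]
  · rw [iteratedDeriv_fun_pow_zero, if_pos rfl, Nat.add_sub_cancel]
    push_cast
    ring
  · intro i _ him
    rw [iteratedDeriv_fun_pow_zero, if_neg him]
    simp
  · intro h
    exfalso
    exact h (Finset.mem_range.mpr (by omega))

/-! ### Identity principle from a real interval -/

/-- A function holomorphic at `0` which vanishes at the real points of an interval `(0, ε)` vanishes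
identically near `0`. [folklore] -/
theorem eventually_eq_zero_of_forall_Ioo {D : ℂ → ℂ} (hD : AnalyticAt ℂ D 0) {ε : ℝ} (hε : 0 < ε)
    (h0 : ∀ s ∈ Set.Ioo (0 : ℝ) ε, D s = 0) : ∀ᶠ z in 𝓝 (0 : ℂ), D z = 0 := by
  rcases hD.eventually_eq_zero_or_eventually_ne_zero with hz | hnz
  · exact hz
  · exfalso
    rw [eventually_nhdsWithin_iff, Metric.eventually_nhds_iff_ball] at hnz
    obtain ⟨r, hr, hball⟩ := hnz
    set s : ℝ := min (ε / 2) (r / 2) with hs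
    have hspos : 0 < s := by positivity
    have hsε : s < ε := lt_of_le_of_lt (min_le_left _ _) (by linarith)
    have hsr : s < r := lt_of_le_of_lt (min_le_right _ _) (by linarith)
    have hmem : ((s : ℝ) : ℂ) ∈ Metric.ball (0 : ℂ) r := by
      rw [Metric.mem_ball, dist_zero_right, Complex.norm_real, Real.norm_eq_abs, abs_of_pos hspos]
      exact hsr
    have hne : ((s : ℝ) : ℂ) ≠ 0 := by exact_mod_cast hspos.ne'
    exact hball _ hmem hne (h0 s ⟨hspos, hsε⟩)

end Literature.FieldTheory.AlgClosed

end
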